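import Summits.AtomisticToContinuum.HydrodynamicLimit.Theorems.AntiMazurCoboundariesCorrectorPressureDecayKiferCanonicalBlowUpDominationCore
import Literature.Analysis.FunctionSpaces.PoissonMeckePrelims

/-!
# The canonical local limit, VII: uniform window domination of the x-averaged blown-up canonical laws (line `FirstLemma`, crux stmt-AtomisticToContinuum-14135)

Registered stub `stub_canonicalBlowUpWindowDomination` (E1-ii) of skeleton v10 of line `FirstLemma`, namespace
`Summit.AtomisticToContinuum.HydrodynamicLimit.Theorems.KiferCompactification`: on every centred box `Λ_n` the window
laws of the x-averaged blown-up canonical laws `canonicalBlowUpLaw σ a θ u₀ N Φ` (`0 < σ ≤ 1/2`, `a, θ > 0`) are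
dominated, UNIFORMLY IN `N`, by ONE finite measure — the input of the abstract setwise-compactness upgrade
`stub_setwiseWindowLimit_of_domination` in `exists_canonicalLocalLimit_of_stubs`.

* `windowRestrict_blowUp_eq_of_labels` / `measure_windowRestrict_blowUp_le_sum` — UNION BOUND OVER LABEL SETS: the
  window configuration of a blown-up labelled configuration is the finite configuration of the blow-ups of the labels
  seen in the window, so the law of the window configuration is bounded by the sum over label sets `S` of the joint
  laws of the blow-ups of the labels of `S` (enumerated increasingly, `Finset.orderEmbOfFin`);
* `measure_pi_windowEvent_eq` — on tuples with all positions in `Λ` the ideal reference law `(Leb ⊗ N(u₀,θ))^{⊗m}`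
  is `(Leb_Λ ⊗ N(u₀,θ))^{⊗m}`;
* `dominatingMeasure_apply`, `isFiniteMeasure_dominatingMeasure` — the majorant
  `R = ∑ₘ (ξᵐ/m!) · cfg_* (Leb_Λ ⊗ N(u₀,θ))^{⊗m}`, `ξ = σ³/(1 - v₁σ³)`, of total mass `exp(ξ · vol Λ) < ∞`;
* `stub_canonicalBlowUpWindowDomination` — assembly: by `localGibbsLaw_blowUpLabels_le` (Core) each label set of
  size `m` costs `((1 - v₁σ³)⁻¹ ε_N³)ᵐ (Leb_Λ ⊗ N)^{⊗m}(cfg ∈ A)`, there are `C(N+1, m) ≤ (N+1)ᵐ/m!` of them and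
  `(N+1) ε_N³ = σ³`; the bound is uniform in the base point, over which one finally averages.

References: H.-O. Georgii, J. Stat. Phys. 80 (1995) §3 (local convergence of averaged canonical ensembles);
D. Ruelle, *Statistical Mechanics: Rigorous Results* (1969) §4.2.
-/

noncomputable section

open MeasureTheory Set Filter Topology Function
open scoped ENNReal NNReal

namespace Summit.AtomisticToContinuum.HydrodynamicLimit.Theorems.KiferCompactification

open Literature.MathematicalPhysics.KineticTheory
open Literature.MathematicalPhysics.KineticTheory.PointProcess (windowLaw windowRestrict centredBox
  measurable_windowRestrict)
open Literature.Analysis.FluidPDE (HardSphereFlow Config)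
open Literature.Analysis.FunctionSpaces (PointConfig)

/-! ## Finite configurations of tuples -/

/-- The finite configuration `{w₁, …, w_m}` depends measurably on the tuple `w` (`PointConfig.measurable_union_ofFn`
with the empty configuration). -/
theorem measurable_ofFn_pointConfig (m : ℕ) : Measurable fun w : Fin m → V3 × V3 => PointConfig.ofFn w := by
  have h := (PointConfig.measurable_union_ofFn (E := V3 × V3) m).comp
    (measurable_id.prodMk (measurable_const (a := (∅ : PointConfig (V3 × V3)))))
  convert h using 1
  funext w
  ext p
  simp only [Function.comp_apply, id_eq, PointConfig.mem_union]
  constructor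
  · exact fun hp => Or.inr hp
  · rintro (hp | hp)
    · exact absurd (show p ∈ (∅ : PointConfig (V3 × V3)).carrier from hp) (by simp)
    · exact hp

/-- The window configuration `cfg_Λ(w) = {w₁, …, w_m} ∩ (Λ × ℝ³)` of a tuple depends measurably on the tuple. -/
theorem measurable_windowRestrict_ofFn {Λ : Set V3} (hΛ : MeasurableSet Λ) (m : ℕ) :
    Measurable fun w : Fin m → V3 × V3 => windowRestrict Λ (PointConfig.ofFn w) :=
  (measurable_windowRestrict hΛ).comp (measurable_ofFn_pointConfig m)

/-! ## The union bound over label sets -/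

/-- **The window configuration of a blow-up through its labels.** If `S` is the set of labels whose blow-up has
position in `Λ`, enumerated increasingly by `ℓ = S.orderEmbOfFin`, then the window configuration of the blown-up
configuration is the window configuration of the tuple `(blowUpPoint ε x (z (ℓ j)))_j`. -/
theorem windowRestrict_blowUp_eq_of_labels (ε : ℝ) (x : T3) (Λ : Set V3) {N : ℕ} (z : Config N (Fin 3) T3)
    (S : Finset (Fin N)) (hS : ∀ i, i ∈ S ↔ (blowUpPoint ε x (z i)).1 ∈ Λ) :
    windowRestrict Λ (blowUp ε x z) =
      windowRestrict Λ (PointConfig.ofFn fun j : Fin S.card => blowUpPoint ε x (z (S.orderEmbOfFin rfl j))) := by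
  ext p
  change (p ∈ blowUp ε x z ∧ p.1 ∈ Λ) ↔
    (p ∈ PointConfig.ofFn (fun j : Fin S.card => blowUpPoint ε x (z (S.orderEmbOfFin rfl j))) ∧ p.1 ∈ Λ)
  rw [mem_blowUp, PointConfig.mem_ofFn]
  constructor
  · rintro ⟨⟨i, rfl⟩, hp⟩
    have hi : i ∈ Set.range (S.orderEmbOfFin rfl) := by
      rw [Finset.range_orderEmbOfFin]
      exact (hS i).2 hp
    obtain ⟨j, hj⟩ := hi
    exact ⟨⟨j, by rw [hj]⟩, hp⟩
  · rintro ⟨⟨j, rfl⟩, hp⟩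
    exact ⟨⟨_, rfl⟩, hp⟩

/-- **Union bound over label sets.** For every law `μ` on `N`-particle torus phase space, scale `ε`, base point
`x`, window `Λ` and event `A` of configurations: the `μ`-probability that the window configuration of the blow-up lies
in `A` is at most the sum over label sets `S` of the `μ`-probability that the blow-ups of the labels of `S` all have
position in `Λ` and their window configuration lies in `A`. -/
theorem measure_windowRestrict_blowUp_le_sum {N : ℕ} (μ : Measure (Config N (Fin 3) T3)) (ε : ℝ) (x : T3)
    (Λ : Set V3) (A : Set (PointConfig (V3 × V3))) :
    μ {z | windowRestrict Λ (blowUp ε x z) ∈ A} ≤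
      ∑ S : Finset (Fin N), μ {z | (fun j : Fin S.card => blowUpPoint ε x (z (S.orderEmbOfFin rfl j))) ∈
        {w : Fin S.card → V3 × V3 | (∀ j, (w j).1 ∈ Λ) ∧ windowRestrict Λ (PointConfig.ofFn w) ∈ A}} := by
  classical
  refine (measure_mono fun z hz => ?_).trans (measure_iUnion_fintype_le μ _)
  set S : Finset (Fin N) := Finset.univ.filter fun i => (blowUpPoint ε x (z i)).1 ∈ Λ with hSdef
  have hS : ∀ i, i ∈ S ↔ (blowUpPoint ε x (z i)).1 ∈ Λ := fun i => by simp [hSdef]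
  refine Set.mem_iUnion.2 ⟨S, ?_, ?_⟩
  · intro j
    exact (hS _).1 (S.orderEmbOfFin_mem rfl j)
  · rw [← windowRestrict_blowUp_eq_of_labels ε x Λ z S hS]
    exact hz

/-! ## The reference law on window tuples -/

/-- The event "all positions in `Λ` and the window configuration lies in `A`" of tuples is measurable. -/
theorem measurableSet_windowEvent {Λ : Set V3} (hΛ : MeasurableSet Λ) (m : ℕ) {A : Set (PointConfig (V3 × V3))}
    (hA : MeasurableSet A) :
    MeasurableSet {w : Fin m → V3 × V3 | (∀ j, (w j).1 ∈ Λ) ∧ windowRestrict Λ (PointConfig.ofFn w) ∈ A} := by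
  have h1 : MeasurableSet {w : Fin m → V3 × V3 | ∀ j, (w j).1 ∈ Λ} := by
    have : {w : Fin m → V3 × V3 | ∀ j, (w j).1 ∈ Λ} = ⋂ j, (fun w : Fin m → V3 × V3 => (w j).1) ⁻¹' Λ := by
      ext w
      simp
    rw [this]
    exact MeasurableSet.iInter fun j => (measurable_pi_apply j).fst hΛ
  exact h1.inter ((measurable_windowRestrict_ofFn hΛ m) hA)

/-- On tuples with all positions in `Λ`, the ideal reference law `(Leb ⊗ N(u₀,θ))^{⊗m}` is the window reference law
`(Leb_Λ ⊗ N(u₀,θ))^{⊗m}` (`Measure.restrict_pi_pi`, `Measure.prod_restrict`). -/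
theorem measure_pi_windowEvent_eq {Λ : Set V3} (hΛ : MeasurableSet Λ) (u₀ : V3) (θ : ℝ) (m : ℕ)
    {A : Set (PointConfig (V3 × V3))} (hA : MeasurableSet A) :
    Measure.pi (fun _ : Fin m => (volume : Measure V3).prod (gaussMeasure u₀ θ))
        {w : Fin m → V3 × V3 | (∀ j, (w j).1 ∈ Λ) ∧ windowRestrict Λ (PointConfig.ofFn w) ∈ A} =
      Measure.pi (fun _ : Fin m => ((volume : Measure V3).restrict Λ).prod (gaussMeasure u₀ θ))
        ((fun w : Fin m → V3 × V3 => windowRestrict Λ (PointConfig.ofFn w)) ⁻¹' A) := by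
  have hset : {w : Fin m → V3 × V3 | (∀ j, (w j).1 ∈ Λ) ∧ windowRestrict Λ (PointConfig.ofFn w) ∈ A} =
      (fun w : Fin m → V3 × V3 => windowRestrict Λ (PointConfig.ofFn w)) ⁻¹' A ∩
        Set.univ.pi fun _ : Fin m => Λ ×ˢ (Set.univ : Set V3) := by
    ext w
    simp only [Set.mem_setOf_eq, Set.mem_inter_iff, Set.mem_preimage, Set.mem_univ_pi, Set.mem_prod, Set.mem_univ,
      and_true]
    exact and_comm
  haveI : SigmaFinite ((volume : Measure V3).prod (gaussMeasure u₀ θ)) := inferInstance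
  haveI : SigmaFinite (((volume : Measure V3).restrict Λ).prod (gaussMeasure u₀ θ)) := inferInstance
  rw [hset, ← Measure.restrict_apply ((measurable_windowRestrict_ofFn hΛ m) hA), Measure.restrict_pi_pi]
  simp_rw [← Measure.prod_restrict, Measure.restrict_univ]

/-! ## The majorant -/

/-- **The value of the majorant on an event.** For the measure
`R = ∑ₘ ofReal(ξᵐ/m!) • cfg_* (Leb_Λ ⊗ N(u₀,θ))^{⊗m}` and a measurable `A`:
`R(A) = ∑ₘ ofReal(ξᵐ/m!) (Leb_Λ ⊗ N(u₀,θ))^{⊗m}(cfg ∈ A)`. -/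
theorem dominatingMeasure_apply {Λ : Set V3} (hΛ : MeasurableSet Λ) (u₀ : V3) (θ ξ : ℝ)
    {A : Set (PointConfig (V3 × V3))} (hA : MeasurableSet A) :
    Measure.sum (fun m : ℕ => ENNReal.ofReal (ξ ^ m / m.factorial) •
        (Measure.pi (fun _ : Fin m => ((volume : Measure V3).restrict Λ).prod (gaussMeasure u₀ θ))).map
          (fun w : Fin m → V3 × V3 => windowRestrict Λ (PointConfig.ofFn w))) A =
      ∑' m : ℕ, ENNReal.ofReal (ξ ^ m / m.factorial) *
        Measure.pi (fun _ : Fin m => ((volume : Measure V3).restrict Λ).prod (gaussMeasure u₀ θ))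
          ((fun w : Fin m → V3 × V3 => windowRestrict Λ (PointConfig.ofFn w)) ⁻¹' A) := by
  rw [Measure.sum_apply _ hA]
  refine tsum_congr fun m => ?_
  rw [Measure.smul_apply, smul_eq_mul, Measure.map_apply (measurable_windowRestrict_ofFn hΛ m) hA]

/-- **The majorant is finite**: its total mass is `∑ₘ ξᵐ Vᵐ/m! = exp(ξ V)`, `V = vol(Λ) < ∞` the mass of
`Leb_Λ ⊗ N(u₀,θ)` (`Λ` bounded, `ξ ≥ 0`). -/
theorem isFiniteMeasure_dominatingMeasure {Λ : Set V3} (hΛ : MeasurableSet Λ) (hΛb : Bornology.IsBounded Λ) (u₀ : V3)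
    (θ : ℝ) {ξ : ℝ} (hξ : 0 ≤ ξ) :
    IsFiniteMeasure (Measure.sum (fun m : ℕ => ENNReal.ofReal (ξ ^ m / m.factorial) •
        (Measure.pi (fun _ : Fin m => ((volume : Measure V3).restrict Λ).prod (gaussMeasure u₀ θ))).map
          (fun w : Fin m → V3 × V3 => windowRestrict Λ (PointConfig.ofFn w)))) := by
  haveI : IsFiniteMeasure ((volume : Measure V3).restrict Λ) := ⟨by
    rw [Measure.restrict_apply_univ]
    exact hΛb.measure_lt_top⟩
  haveI hfin : IsFiniteMeasure (((volume : Measure V3).restrict Λ).prod (gaussMeasure u₀ θ)) := inferInstance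
  haveI : SigmaFinite (((volume : Measure V3).restrict Λ).prod (gaussMeasure u₀ θ)) := inferInstance
  obtain ⟨t, ht0, hVt⟩ : ∃ t : ℝ, 0 ≤ t ∧
      (((volume : Measure V3).restrict Λ).prod (gaussMeasure u₀ θ)) Set.univ = ENNReal.ofReal t :=
    ⟨_, ENNReal.toReal_nonneg, (ENNReal.ofReal_toReal (measure_ne_top _ _)).symm⟩
  refine ⟨?_⟩
  rw [dominatingMeasure_apply hΛ u₀ θ ξ MeasurableSet.univ]
  simp only [Set.preimage_univ, Measure.pi_univ, Finset.prod_const, Finset.card_univ, Fintype.card_fin, hVt]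
  have hterm : ∀ m : ℕ, ENNReal.ofReal (ξ ^ m / m.factorial) * ENNReal.ofReal t ^ m =
      ENNReal.ofReal ((ξ * t) ^ m / m.factorial) := by
    intro m
    rw [← ENNReal.ofReal_pow ht0, ← ENNReal.ofReal_mul (by positivity), mul_pow]
    congr 1
    ring
  simp_rw [hterm]
  rw [← ENNReal.ofReal_tsum_of_nonneg (fun m => by positivity) (Real.summable_pow_div_factorial _)]
  exact ENNReal.ofReal_lt_top

/-! ## Combinatorics of the label sets -/

/-- `C(N+1, m) · ((1 - v₁σ³)⁻¹ ε_N³)ᵐ ≤ ξᵐ/m!` with `ξ = (1 - v₁σ³)⁻¹ σ³`: `C(N+1, m) ≤ (N+1)ᵐ/m!` and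
`(N+1) ε_N³ = σ³`. -/
theorem choose_mul_labelCost_le {σ : ℝ} (hσ : 0 < σ) (hσ2 : σ ≤ 1 / 2) (N m : ℕ) :
    ((N + 1).choose m : ℝ) * ((1 - v₁ * σ ^ 3)⁻¹ * hsDiameter σ N ^ 3) ^ m ≤
      ((1 - v₁ * σ ^ 3)⁻¹ * σ ^ 3) ^ m / m.factorial := by
  have hc0 : 0 ≤ (1 - v₁ * σ ^ 3)⁻¹ := by
    have := v₁_mul_cube_le hσ.le hσ2
    exact inv_nonneg.2 (by linarith)
  have hN : (0 : ℝ) < (N + 1 : ℕ) := by positivity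
  have hε3 : hsDiameter σ N ^ 3 = σ ^ 3 / (N + 1 : ℕ) := by
    rw [eq_div_iff hN.ne', mul_comm]
    exact succ_mul_hsDiameter_pow_three σ N
  have hchoose : ((N + 1).choose m : ℝ) ≤ ((N + 1 : ℕ) : ℝ) ^ m / m.factorial := by
    have h := Nat.choose_le_pow_div (α := ℝ) m (N + 1)
    push_cast at h ⊢
    exact h
  have hfac : (0 : ℝ) < m.factorial := by positivity
  rw [hε3, mul_pow, mul_pow, div_pow, le_div_iff₀ hfac]
  rw [le_div_iff₀ hfac] at hchoose
  have hpow : (0 : ℝ) < ((N + 1 : ℕ) : ℝ) ^ m := by positivity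
  calc ((N + 1).choose m : ℝ) * ((1 - v₁ * σ ^ 3)⁻¹ ^ m * ((σ ^ 3) ^ m / ((N + 1 : ℕ) : ℝ) ^ m)) * m.factorial
      = ((N + 1).choose m : ℝ) * m.factorial / ((N + 1 : ℕ) : ℝ) ^ m * ((1 - v₁ * σ ^ 3)⁻¹ ^ m * (σ ^ 3) ^ m) := by
        field_simp
    _ ≤ 1 * ((1 - v₁ * σ ^ 3)⁻¹ ^ m * (σ ^ 3) ^ m) := by
        refine mul_le_mul_of_nonneg_right ?_ (by positivity)
        rw [div_le_one hpow]
        exact hchoose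
    _ = (1 - v₁ * σ ^ 3)⁻¹ ^ m * (σ ^ 3) ^ m := one_mul _

/-! ## The stub -/

/-- (E1-ii) **UNIFORM WINDOW DOMINATION.** For `0 < σ ≤ 1/2`, `a, θ > 0` and every centred box `Λ_n` there is ONE
finite measure `R` on configurations dominating setwise the window laws on `Λ_n` of the x-averaged blown-up canonical
laws of EVERY size `N` (and every flow `Φ`, on which the law does not depend): the majorant is
`R = ∑ₘ (ξᵐ/m!) · cfg_* (Leb_{Λ_n} ⊗ N(u₀,θ))^{⊗m}`, `ξ = σ³/(1 - v₁σ³)`, of total mass `exp(ξ vol Λ_n)`. Proof: Fubini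
over the base point; for a fixed base point the union bound over the label sets seen in the window
(`measure_windowRestrict_blowUp_le_sum`), Ruelle's bound with the iterated insertion bound and the blow-up change of
variables for each label set (`localGibbsLaw_blowUpLabels_le`), and `C(N+1, m) ((1 - v₁σ³)⁻¹ ε_N³)ᵐ ≤ ξᵐ/m!`.
Registered stub of skeleton v10 of line `FirstLemma` (crux stmt-AtomisticToContinuum-14135). -/
theorem stub_canonicalBlowUpWindowDomination : ∀ (σ a θ : ℝ) (u₀ : V3), 0 < σ → σ ≤ 1 / 2 → 0 < a → 0 < θ →
    ∀ n : ℕ, ∃ R : Measure (PointConfig (V3 × V3)), IsFiniteMeasure R ∧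
      ∀ (N : ℕ) (Φ : HardSphereFlow (Literature.Analysis.FluidPDE.Torus.geometry (Fin 3)) (hsDiameter σ N) (N + 1)),
        windowLaw (centredBox n) (canonicalBlowUpLaw σ a θ u₀ N Φ) ≤ R := by
  intro σ a θ u₀ hσ hσ2 ha hθ n
  classical
  set Λ : Set V3 := centredBox n with hΛdef
  have hΛ : MeasurableSet Λ := measurableSet_centredBox_fin3 n
  have hΛb : Bornology.IsBounded Λ := isBounded_centredBox n
  set c : ℝ := (1 - v₁ * σ ^ 3)⁻¹ with hcdef
  set ξ : ℝ := c * σ ^ 3 with hξdef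
  have hc0 : 0 ≤ c := by
    have := v₁_mul_cube_le hσ.le hσ2
    exact inv_nonneg.2 (by linarith)
  have hξ0 : 0 ≤ ξ := mul_nonneg hc0 (pow_nonneg hσ.le 3)
  set ρ : Measure (V3 × V3) := ((volume : Measure V3).restrict Λ).prod (gaussMeasure u₀ θ) with hρ
  set cfg : (m : ℕ) → (Fin m → V3 × V3) → PointConfig (V3 × V3) := fun m w => windowRestrict Λ (PointConfig.ofFn w)
    with hcfg
  refine ⟨Measure.sum (fun m : ℕ => ENNReal.ofReal (ξ ^ m / m.factorial) •
      (Measure.pi (fun _ : Fin m => ρ)).map (cfg m)), isFiniteMeasure_dominatingMeasure hΛ hΛb u₀ θ hξ0, ?_⟩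
  intro N Φ
  haveI : IsProbabilityMeasure (volume : Measure T3) := by rw [volume_pi]; infer_instance
  haveI := isProbabilityMeasure_localGibbsLaw (a₀ := fun _ => a) (θ₀ := fun _ => θ) (u₀ := fun _ => u₀)
    continuous_const continuous_const continuous_const (fun _ => ha) (fun _ => hθ) hσ2 N Φ
  set LG := localGibbsLaw σ (fun _ => a) (fun _ => u₀) (fun _ => θ) N Φ with hLG
  refine Measure.le_iff.2 fun A hA => ?_
  rw [dominatingMeasure_apply hΛ u₀ θ ξ hA]
  -- the window law as a base-point average
  have hpre : MeasurableSet {p : T3 × Config (N + 1) (Fin 3) T3 |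
      windowRestrict Λ (blowUp (hsDiameter σ N) p.1 p.2) ∈ A} :=
    ((measurable_windowRestrict hΛ).comp (measurable_blowUp (hsDiameter σ N) (N + 1))) hA
  have hwl : windowLaw Λ (canonicalBlowUpLaw σ a θ u₀ N Φ) A =
      ∫⁻ x : T3, LG {z | windowRestrict Λ (blowUp (hsDiameter σ N) x z) ∈ A} ∂volume := by
    rw [windowLaw, Measure.map_apply (measurable_windowRestrict hΛ) hA, canonicalBlowUpLaw,
      Measure.map_apply (measurable_blowUp _ _) (measurable_windowRestrict hΛ hA)]
    exact Measure.prod_apply hpre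
  -- the bound for a fixed base point
  have hx : ∀ x : T3, LG {z | windowRestrict Λ (blowUp (hsDiameter σ N) x z) ∈ A} ≤
      ∑' m : ℕ, ENNReal.ofReal (ξ ^ m / m.factorial) * Measure.pi (fun _ : Fin m => ρ) (cfg m ⁻¹' A) := by
    intro x
    refine (measure_windowRestrict_blowUp_le_sum LG (hsDiameter σ N) x Λ A).trans ?_
    have hterm : ∀ S : Finset (Fin (N + 1)),
        LG {z | (fun j : Fin S.card => blowUpPoint (hsDiameter σ N) x (z (S.orderEmbOfFin rfl j))) ∈
          {w : Fin S.card → V3 × V3 | (∀ j, (w j).1 ∈ Λ) ∧ windowRestrict Λ (PointConfig.ofFn w) ∈ A}} ≤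
          ENNReal.ofReal ((c * hsDiameter σ N ^ 3) ^ S.card) *
            Measure.pi (fun _ : Fin S.card => ρ) (cfg S.card ⁻¹' A) := by
      intro S
      have hF := measurableSet_windowEvent hΛ S.card hA
      refine (localGibbsLaw_blowUpLabels_le hσ hσ2 ha hθ u₀ x N Φ (S.orderEmbOfFin rfl).injective hF).trans ?_
      rw [measure_pi_windowEvent_eq hΛ u₀ θ S.card hA]
    calc ∑ S : Finset (Fin (N + 1)),
          LG {z | (fun j : Fin S.card => blowUpPoint (hsDiameter σ N) x (z (S.orderEmbOfFin rfl j))) ∈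
            {w : Fin S.card → V3 × V3 | (∀ j, (w j).1 ∈ Λ) ∧ windowRestrict Λ (PointConfig.ofFn w) ∈ A}}
        ≤ ∑ S : Finset (Fin (N + 1)), ENNReal.ofReal ((c * hsDiameter σ N ^ 3) ^ S.card) *
            Measure.pi (fun _ : Fin S.card => ρ) (cfg S.card ⁻¹' A) := Finset.sum_le_sum fun S _ => hterm S
      _ = ∑ m ∈ Finset.range (N + 1 + 1), ((N + 1).choose m : ℝ≥0∞) *
            (ENNReal.ofReal ((c * hsDiameter σ N ^ 3) ^ m) * Measure.pi (fun _ : Fin m => ρ) (cfg m ⁻¹' A)) := by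
          rw [← Finset.powerset_univ, Finset.sum_powerset_apply_card
            (fun m => ENNReal.ofReal ((c * hsDiameter σ N ^ 3) ^ m) * Measure.pi (fun _ : Fin m => ρ) (cfg m ⁻¹' A)),
            Finset.card_univ, Fintype.card_fin]
          simp_rw [nsmul_eq_mul]
      _ ≤ ∑ m ∈ Finset.range (N + 1 + 1), ENNReal.ofReal (ξ ^ m / m.factorial) *
            Measure.pi (fun _ : Fin m => ρ) (cfg m ⁻¹' A) := by
          refine Finset.sum_le_sum fun m _ => ?_
          rw [← mul_assoc]
          refine mul_le_mul' ?_ le_rfl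
          rw [← ENNReal.ofReal_natCast, ← ENNReal.ofReal_mul (Nat.cast_nonneg _)]
          exact ENNReal.ofReal_le_ofReal (choose_mul_labelCost_le hσ hσ2 N m)
      _ ≤ ∑' m : ℕ, ENNReal.ofReal (ξ ^ m / m.factorial) * Measure.pi (fun _ : Fin m => ρ) (cfg m ⁻¹' A) :=
          ENNReal.sum_le_tsum _
  rw [hwl]
  calc ∫⁻ x : T3, LG {z | windowRestrict Λ (blowUp (hsDiameter σ N) x z) ∈ A} ∂volume
      ≤ ∫⁻ _ : T3, ∑' m : ℕ, ENNReal.ofReal (ξ ^ m / m.factorial) * Measure.pi (fun _ : Fin m => ρ) (cfg m ⁻¹' A)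
          ∂volume := lintegral_mono hx
    _ = _ := by rw [lintegral_const, measure_univ, mul_one]

end Summit.AtomisticToContinuum.HydrodynamicLimit.Theorems.KiferCompactification

end
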